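import Literature.Geometry.Kaehler.HolomorphicChainLelongLevelSetsLimit
import Literature.Geometry.Kaehler.HolomorphicChainPositiveWeakLimit
import Literature.Geometry.Kaehler.LelongNumberComponents
import HarnessLib

/-!
# Sequences of analytic sets as currents

Layer `Literature/Geometry/Kaehler`; lane `lit-hodgefound`, seat p07, programme «MINIMALITY & MASS»,
file 9. An analytic subset `A ⊆ Ω` of pure dimension `p` "is a holomorphic chain with all
multiplicities `1`" [Chirka1989, §11.5], realised in the tree as `HolomorphicChain.ofSet A`
(`AnalyticSetChain.lean`), whose current `[A](φ) = ∫_{reg A} φ` is the current of integration over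
`A` [Chirka1989, §14.1 Cor.]. This file identifies the mass measure and the Lelong numbers of the
chain `[A]` with the volume measure `𝓗_{2p}|_A` and the Lelong numbers of the SET `A`, and reads
off, for sequences of analytic sets `A_j` whose currents converge, `[A_j] → [A]`, the statements of
[Chirka1989, §15.5 (p. 205) and §16.1 Prop. 1] proved in the tree for positive holomorphic chains:

* `HolomorphicChain.variation_toCurrent_ofSet` — **`‖[A]‖ = 𝓗^{2p} ⌞ A`** (Chirka's measure
  `μ_A = 𝓗_{2p}|_A`, "`μ(E) = 𝓗_{2p}(E ∩ A)` for all Borel `E`", §15.5 p. 205; §16.1 p. 206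
  "`M_K T = Σ |k_i| 𝓗_{2p}(K ∩ A_i)`" with all `k_i = 1`);
  `HolomorphicChain.toCurrent_ofSet_smul_kaehlerPow_apply` — `[A](χ K_p) = ∫_A χ d𝓗^{2p}`
  (Wirtinger's equality `vol_{2p} A = (1/p!) ∫_A ω^p` in the tree's normalisation `K_p`,
  [Chirka1989, §13.3 Cor.]);
  `HolomorphicChain.finsum_lelongNumber_ofSet` — **`n([A], a) = n(A, a)`**: the Lelong number of
  the chain `[A]` (`Σ_Z |k_Z| n(Z, a)`) is the Lelong number of `A` [Chirka1989, §15.1 Prop. 2];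
* for `[A_j] → [A]` in the sense of currents (`A_j`, `A` of pure dimension `p = q + 1`):
  `measure_inter_le_liminf_of_tendsto_ofSet` (**`𝓗^{2p}(A ∩ U) ≤ liminf 𝓗^{2p}(A_j ∩ U)`**, `U`
  open), `limsup_measure_inter_le_of_tendsto_ofSet` (`limsup 𝓗^{2p}(A_j ∩ K) ≤ 𝓗^{2p}(A ∩ K)`,
  `K ⊆ Ω` compact), `tendsto_measure_inter_of_tendsto_ofSet` (**the volumes converge on
  continuity sets**, `𝓗^{2p}(A ∩ ∂S) = 0`), `tendsto_measure_inter_ball_of_tendsto_ofSet`,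
  `tendsto_setIntegral_of_tendsto_ofSet` (**`𝓗_{2p}|_{A_j} → 𝓗_{2p}|_A` weak-∗**, §15.5 p. 205);
  `limsup_lelongNumber_le_of_tendsto_ofSet(_of_tendsto)` (**upper semicontinuity of the Lelong
  number**, fixed and moving centres), `le_lelongNumber_of_tendsto_ofSet_of_frequently_le`,
  `mem_singularLocus_of_tendsto_ofSet_of_frequently_two_le` (limits of points of multiplicity
  `≥ 2` are singular points of the limit); `tendsto_sets_of_tendsto_ofSet` (**`A_j → A` in the
  sense of §15.5**: `A` is the limit set of `{A_j}` in `Ω` and compact parts of `A` lie in the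
  `ε`-neighbourhoods of the `A_j` for large `j`);
* `exists_subseq_tendsto_toCurrent_ofSet` — **compactness** [Chirka1989, §15.5 p. 205, §16.1
  Prop. 1 (2)]: pure `p`-dimensional analytic sets with locally uniformly bounded volumes have a
  subsequence whose currents converge to a positive holomorphic `p`-chain `T`; and for any such
  limit, `mem_image_support_iff_of_tendsto_ofSet` (`|T|` is the limit set of the `A_j` in `Ω` —
  "`A = supp μ ∩ Ω` coincides with the limit set", §15.5 p. 205), `eventually_subset_thickening_of_tendsto_ofSet`
  (`A_j → |T|`; `|T|` is empty or of pure dimension `p`, `HolomorphicChain.hasPureDim_support` —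
  Bishop's theorem), `measure_support_inter_le_liminf_of_tendsto_ofSet`
  (`𝓗^{2p}(|T| ∩ U) ≤ liminf 𝓗^{2p}(A_j ∩ U)`).

Theorems only; no new definitions, no named facts. Everything is a specialisation of the chain
statements of `HolomorphicChainMassConvergence.lean`, `HolomorphicChainLelongSemicontinuity.lean`,
`HolomorphicChainLelongLevelSetsLimit.lean`, `HolomorphicChainSupportConvergence.lean`,
`HolomorphicChainPositiveLimit.lean` and `HolomorphicChainPositiveWeakLimit.lean` to the chains
`[A_j]`, via `θ_{[A]} = 1` on `reg A` and `𝓗^{2p}(sng A) = 0`.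

## References

* [Chirka1989] E. M. Chirka, *Complex Analytic Sets*, Kluwer 1989, §11.5 (p. 130), §13.3 Cor.,
  §14.1 Cor. (p. 174), §15.1 Prop. 2 (p. 190), §15.5 (pp. 202–205), §16.1 Prop. 1 (pp. 206–207)
  (held `book:chirkand-complex-analytic-sets`, PDF p0210–p0215).
* [Federer1969] H. Federer, *Geometric Measure Theory*, Springer 1969, 4.1.5, 4.1.7, 5.4.19.
-/

noncomputable section

open scoped Manifold Topology ENNReal NNReal Distributions
open Set Filter MeasureTheory Metric Function TopologicalSpace

namespace Literature.Geometry.Kaehler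

open Literature.Geometry.GeometricMeasureTheory

-- Nested operator-norm instances on (duals of) `V [⋀^Fin n]→L[ℝ] ℝ`, as in `Currents.lean`.
set_option maxSynthPendingDepth 2

universe u

namespace HolomorphicChain

/-! ## §1. The mass measure and the Lelong numbers of `[A]` -/

section Mult

variable {E : Type*} [NormedAddCommGroup E] [NormedSpace ℂ E]
  {H : Type*} [TopologicalSpace H] {I : ModelWithCorners ℂ E H}
  {M : Type*} [TopologicalSpace M] [ChartedSpace H M] [FiniteDimensional ℂ E]
  [IsManifold I 1 M] [I.Boundaryless] {p : ℕ}

/-- `[A]` is a positive chain: all its multiplicities are `0` or `1`. [cite: Chirka1989, §11.5, p. 130] -/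
theorem mult_ofSet_nonneg {A : Set M} (hA : HasPureDim I A p) (Z : Set M) :
    0 ≤ (ofSet A hA).mult Z := by
  classical
  rw [mult_ofSet]
  split_ifs <;> simp

/-- The nonzero multiplicities of `[A]` are `1` ("an analytic set is a holomorphic chain with all
multiplicities `1`"). [cite: Chirka1989, §11.5, p. 130] -/
theorem mult_ofSet_eq_one {A : Set M} (hA : HasPureDim I A p) {Z : Set M}
    (hZ : (ofSet A hA).mult Z ≠ 0) : (ofSet A hA).mult Z = 1 := by
  classical
  rw [mult_ofSet] at hZ ⊢
  by_cases h : IsIrreducibleComponent I A Z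
  · rw [if_pos h]
  · exact absurd (if_neg h) hZ

end Mult

variable {V : Type u} [NormedAddCommGroup V] [InnerProductSpace ℂ V] [FiniteDimensional ℂ V]
  [MeasurableSpace V] [BorelSpace V] {Ω : Opens V} {q : ℕ}

section OfSet

variable {p : ℕ}

/-- **`‖[A]‖(S) = 𝓗^{2p}(A ∩ S)`** for Borel `S`: the mass of the current of integration over `A` is
the `2p`-volume of `A` (`θ_{[A]} = 1` on `reg A`, `𝓗^{2p}(sng A) = 0`) — Chirka's
`M_K[A] = 𝓗_{2p}(K ∩ A)`. [cite: Chirka1989, §16.1, p. 206; §14.1, p. 174] -/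
theorem variation_toCurrent_ofSet_apply {A : Set Ω} (hA : HasPureDim 𝓘(ℂ, V) A p) {S : Set V}
    (hS : MeasurableSet S) :
    (ofSet A hA).toCurrent.variation S =
      (μHE[2 * p] : Measure V) (((↑) : Ω → V) '' A ∩ S) := by
  rw [(ofSet A hA).variation_toCurrent_apply hS, measure_image_inter_eq_carrier_inter hA S,
    ← setLIntegral_one]
  refine setLIntegral_congr_fun ((ofSet A hA).measurableSet_carrier.inter hS) fun x hx => ?_
  rw [density_ofSet_of_mem_carrier hA hx.1]
  simp

/-- **`‖[A]‖ = 𝓗^{2p} ⌞ A`**: the mass measure of `[A]` is the measure `μ_A(E) = 𝓗_{2p}(E ∩ A)`.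
[cite: Chirka1989, §15.5, p. 205; §16.1, p. 206] -/
theorem variation_toCurrent_ofSet {A : Set Ω} (hA : HasPureDim 𝓘(ℂ, V) A p) :
    (ofSet A hA).toCurrent.variation =
      (μHE[2 * p] : Measure V).restrict (((↑) : Ω → V) '' A) := by
  refine Measure.ext fun S hS => ?_
  rw [variation_toCurrent_ofSet_apply hA hS, Measure.restrict_apply hS, inter_comm]

/-- `∫ f d‖[A]‖ = ∫_A f d𝓗^{2p}`. [cite: Chirka1989, §15.5, p. 205] -/
theorem integral_variation_toCurrent_ofSet {A : Set Ω} (hA : HasPureDim 𝓘(ℂ, V) A p) (f : V → ℝ) :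
    ∫ x, f x ∂(ofSet A hA).toCurrent.variation =
      ∫ x in ((↑) : Ω → V) '' A, f x ∂(μHE[2 * p] : Measure V) := by
  rw [variation_toCurrent_ofSet hA]

end OfSet

/-- **`[A](χ K_p) = ∫_A χ d𝓗^{2p}`** for every test function `χ` (`p = q + 1`): Wirtinger's
equality `vol_{2p}(A) = (1/p!) ∫_A ω^p` in the tree's normalisation of `K_p = kaehlerPow p`
(`K_p(ξ_A) = 1` on `reg A`). [cite: Chirka1989, §13.3 Cor., p. 169; Federer1969, 5.4.19] -/
theorem toCurrent_ofSet_smul_kaehlerPow_apply {A : Set Ω} (hA : HasPureDim 𝓘(ℂ, V) A (q + 1))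
    (χ : 𝓓(Ω, ℝ)) :
    (ofSet A hA).toCurrent (smulCovectorCLM (kaehlerPow (q + 1)) χ) =
      ∫ x in ((↑) : Ω → V) '' A, χ x ∂(μHE[2 * (q + 1)] : Measure V) := by
  rw [← (ofSet A hA).integral_variation_toCurrent_eq (mult_ofSet_nonneg hA) χ,
    integral_variation_toCurrent_ofSet hA]

/-- **`n([A], a) = n(A, a)`**: the Lelong number `Σ_Z |k_Z| n(Z, a)` of the chain `[A]` at `a ∈ Ω` is
the Lelong number of `A` at `a` (additivity of the Lelong number over the irreducible components,
`lelongNumber_eq_finsum_isIrreducibleComponent`). [cite: Chirka1989, §15.1 Prop. 2, p. 190; §11.1, p. 102] -/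
theorem finsum_lelongNumber_ofSet {A : Set Ω} (hA : HasPureDim 𝓘(ℂ, V) A (q + 1)) {a : V}
    (ha : a ∈ (Ω : Set V)) :
    (∑ᶠ Z : Set Ω, ENNReal.ofReal |((ofSet A hA).mult Z : ℝ)| * lelongNumber Z (q + 1) a) =
      lelongNumber A (q + 1) a := by
  classical
  rw [lelongNumber_eq_finsum_isIrreducibleComponent hA ha]
  refine finsum_congr fun Z => ?_
  rw [mult_ofSet]
  split_ifs <;> simp

end HolomorphicChain

variable {V : Type u} [NormedAddCommGroup V] [InnerProductSpace ℂ V] [FiniteDimensional ℂ V]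
  [MeasurableSpace V] [BorelSpace V] {Ω : Opens V} {q : ℕ}

/-! ## §2. Sequences of analytic sets whose currents converge: `[A_j] → [A]` -/

section Convergence

open HolomorphicChain

variable {A : ℕ → Set Ω} (hA : ∀ j, HasPureDim 𝓘(ℂ, V) (A j) (q + 1)) {A' : Set Ω}
  (hA' : HasPureDim 𝓘(ℂ, V) A' (q + 1))

/-- **Lower semicontinuity of the volume on open sets**: if `[A_j] → [A]` in the sense of currents
then `𝓗^{2p}(A ∩ U) ≤ liminf_j 𝓗^{2p}(A_j ∩ U)` for every open `U` (`‖·‖(U)` is weakly lower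
semicontinuous). [cite: Federer1969, 4.1.5 and 4.1.7; Chirka1989, §16.1, p. 206] -/
theorem measure_inter_le_liminf_of_tendsto_ofSet
    (hconv : ∀ ψ, Tendsto (fun j => (ofSet (A j) (hA j)).toCurrent ψ) atTop
      (𝓝 ((ofSet A' hA').toCurrent ψ)))
    {U : Set V} (hU : IsOpen U) :
    (μHE[2 * (q + 1)] : Measure V) (((↑) : Ω → V) '' A' ∩ U) ≤
      liminf (fun j => (μHE[2 * (q + 1)] : Measure V) (((↑) : Ω → V) '' A j ∩ U)) atTop := by
  have h := variation_le_liminf_of_tendsto (fun j => ofSet (A j) (hA j)) hconv hU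
  rw [variation_toCurrent_ofSet_apply hA' hU.measurableSet] at h
  refine h.trans_eq (liminf_congr (Eventually.of_forall fun j => ?_))
  exact variation_toCurrent_ofSet_apply (hA j) hU.measurableSet

/-- **Upper semicontinuity of the volume on compact sets**: if `[A_j] → [A]` in the sense of
currents then `limsup_j 𝓗^{2p}(A_j ∩ K) ≤ 𝓗^{2p}(A ∩ K)` for every compact `K ⊆ Ω`.
[cite: Chirka1989, §15.5, p. 204; §16.1 Prop. 1, p. 207] -/
theorem limsup_measure_inter_le_of_tendsto_ofSet
    (hconv : ∀ ψ, Tendsto (fun j => (ofSet (A j) (hA j)).toCurrent ψ) atTop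
      (𝓝 ((ofSet A' hA').toCurrent ψ)))
    {K : Set V} (hK : IsCompact K) (hKΩ : K ⊆ (Ω : Set V)) :
    limsup (fun j => (μHE[2 * (q + 1)] : Measure V) (((↑) : Ω → V) '' A j ∩ K)) atTop ≤
      (μHE[2 * (q + 1)] : Measure V) (((↑) : Ω → V) '' A' ∩ K) := by
  have h := limsup_variation_le_of_tendsto (fun j => ofSet (A j) (hA j))
    (fun j Z => mult_ofSet_nonneg (hA j) Z) hconv hK hKΩ
  rw [variation_toCurrent_ofSet_apply hA' hK.measurableSet] at h
  refine (limsup_congr (Eventually.of_forall fun j => ?_)).trans_le h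
  exact (variation_toCurrent_ofSet_apply (hA j) hK.measurableSet).symm

/-- **The volumes converge on continuity sets**: if `[A_j] → [A]` in the sense of currents and
`S` is a Borel set with compact closure in `Ω` and `𝓗^{2p}(A ∩ ∂S) = 0`, then
`𝓗^{2p}(A_j ∩ S) → 𝓗^{2p}(A ∩ S)`. [cite: Chirka1989, §15.5, p. 204; §16.1 Prop. 1, p. 207] -/
theorem tendsto_measure_inter_of_tendsto_ofSet
    (hconv : ∀ ψ, Tendsto (fun j => (ofSet (A j) (hA j)).toCurrent ψ) atTop
      (𝓝 ((ofSet A' hA').toCurrent ψ)))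
    {S : Set V} (hS : MeasurableSet S) (hSc : IsCompact (closure S))
    (hSΩ : closure S ⊆ (Ω : Set V))
    (hS0 : (μHE[2 * (q + 1)] : Measure V) (((↑) : Ω → V) '' A' ∩ frontier S) = 0) :
    Tendsto (fun j => (μHE[2 * (q + 1)] : Measure V) (((↑) : Ω → V) '' A j ∩ S)) atTop
      (𝓝 ((μHE[2 * (q + 1)] : Measure V) (((↑) : Ω → V) '' A' ∩ S))) := by
  have h := tendsto_variation_of_null_frontier (fun j => ofSet (A j) (hA j))
    (fun j Z => mult_ofSet_nonneg (hA j) Z) hconv hSc hSΩ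
    (by rw [variation_toCurrent_ofSet_apply hA' isClosed_frontier.measurableSet]; exact hS0)
  rw [variation_toCurrent_ofSet_apply hA' hS] at h
  exact h.congr fun j => variation_toCurrent_ofSet_apply (hA j) hS

/-- **The volumes in balls converge**: if `[A_j] → [A]` in the sense of currents, `𝐁(a, r) ⊆ Ω`
(`0 < r`) and `𝓗^{2p}(A ∩ S(a, r)) = 0`, then `𝓗^{2p}(A_j ∩ B(a,r)) → 𝓗^{2p}(A ∩ B(a,r))`.
[cite: Chirka1989, §16.1 Prop. 1, p. 207] -/
theorem tendsto_measure_inter_ball_of_tendsto_ofSet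
    (hconv : ∀ ψ, Tendsto (fun j => (ofSet (A j) (hA j)).toCurrent ψ) atTop
      (𝓝 ((ofSet A' hA').toCurrent ψ)))
    {a : V} {r : ℝ} (hr : 0 < r) (hB : closedBall a r ⊆ (Ω : Set V))
    (h0 : (μHE[2 * (q + 1)] : Measure V) (((↑) : Ω → V) '' A' ∩ sphere a r) = 0) :
    Tendsto (fun j => (μHE[2 * (q + 1)] : Measure V) (((↑) : Ω → V) '' A j ∩ ball a r)) atTop
      (𝓝 ((μHE[2 * (q + 1)] : Measure V) (((↑) : Ω → V) '' A' ∩ ball a r))) := by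
  haveI : FiniteDimensional ℝ V := FiniteDimensional.complexToReal V
  refine tendsto_measure_inter_of_tendsto_ofSet hA hA' hconv measurableSet_ball ?_ ?_ ?_
  · rw [closure_ball a hr.ne']
    exact isCompact_closedBall a r
  · rw [closure_ball a hr.ne']
    exact hB
  · rwa [frontier_ball a hr.ne']

/-- **`𝓗_{2p}|_{A_j} → 𝓗_{2p}|_A` weak-∗**: if `[A_j] → [A]` in the sense of currents then
`∫_{A_j} χ d𝓗^{2p} → ∫_A χ d𝓗^{2p}` for every test function `χ` on `Ω` (both sides are
`[·](χ K_p)`). [cite: Chirka1989, §15.5, p. 205; §16.1 Prop. 1, pp. 206–207] -/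
theorem tendsto_setIntegral_of_tendsto_ofSet
    (hconv : ∀ ψ, Tendsto (fun j => (ofSet (A j) (hA j)).toCurrent ψ) atTop
      (𝓝 ((ofSet A' hA').toCurrent ψ)))
    (χ : 𝓓(Ω, ℝ)) :
    Tendsto (fun j => ∫ x in ((↑) : Ω → V) '' A j, χ x ∂(μHE[2 * (q + 1)] : Measure V)) atTop
      (𝓝 (∫ x in ((↑) : Ω → V) '' A', χ x ∂(μHE[2 * (q + 1)] : Measure V))) := by
  have h := hconv (smulCovectorCLM (kaehlerPow (q + 1)) χ)
  rw [toCurrent_ofSet_smul_kaehlerPow_apply hA' χ] at h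
  exact h.congr fun j => toCurrent_ofSet_smul_kaehlerPow_apply (hA j) χ

/-- **Upper semicontinuity of the Lelong number under convergence of the currents**: if
`[A_j] → [A]` in the sense of currents then `limsup_j n(A_j, a) ≤ n(A, a)` at every `a ∈ Ω`.
[cite: Chirka1989, §16.1 Prop. 1 (proof), p. 207] -/
theorem limsup_lelongNumber_le_of_tendsto_ofSet
    (hconv : ∀ ψ, Tendsto (fun j => (ofSet (A j) (hA j)).toCurrent ψ) atTop
      (𝓝 ((ofSet A' hA').toCurrent ψ)))
    {a : V} (ha : a ∈ (Ω : Set V)) :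
    limsup (fun j => lelongNumber (A j) (q + 1) a) atTop ≤ lelongNumber A' (q + 1) a := by
  have h := limsup_finsum_lelongNumber_le_of_tendsto (fun j => ofSet (A j) (hA j))
    (fun j Z => mult_ofSet_nonneg (hA j) Z) hconv ha
  rw [finsum_lelongNumber_ofSet hA' ha] at h
  refine (limsup_congr (Eventually.of_forall fun j => ?_)).trans_le h
  exact (finsum_lelongNumber_ofSet (hA j) ha).symm

/-- **Joint upper semicontinuity**: if `[A_j] → [A]` in the sense of currents and `a_j → a ∈ Ω`,
then `limsup_j n(A_j, a_j) ≤ n(A, a)`. [cite: Chirka1989, §16.1 Prop. 1 (proof), p. 207] -/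
theorem limsup_lelongNumber_le_of_tendsto_ofSet_of_tendsto
    (hconv : ∀ ψ, Tendsto (fun j => (ofSet (A j) (hA j)).toCurrent ψ) atTop
      (𝓝 ((ofSet A' hA').toCurrent ψ)))
    {c : ℕ → V} {a : V} (ha : a ∈ (Ω : Set V)) (hc : Tendsto c atTop (𝓝 a)) :
    limsup (fun j => lelongNumber (A j) (q + 1) (c j)) atTop ≤ lelongNumber A' (q + 1) a := by
  have h := limsup_finsum_lelongNumber_le_of_tendsto_of_tendsto (fun j => ofSet (A j) (hA j))
    (fun j Z => mult_ofSet_nonneg (hA j) Z) hconv ha hc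
  rw [finsum_lelongNumber_ofSet hA' ha] at h
  refine (limsup_congr ?_).trans_le h
  filter_upwards [hc.eventually (Ω.isOpen.mem_nhds ha)] with j hj
  exact (finsum_lelongNumber_ofSet (hA j) hj).symm

/-- **Lelong numbers `≥ m` persist in the limit**: if `[A_j] → [A]` in the sense of currents,
`a_j → a ∈ Ω` and `n(A_j, a_j) ≥ m` for infinitely many `j`, then `n(A, a) ≥ m`.
[cite: Chirka1989, §16.1 Prop. 1 (proof), p. 207; §11.1, p. 120] -/
theorem le_lelongNumber_of_tendsto_ofSet_of_frequently_le
    (hconv : ∀ ψ, Tendsto (fun j => (ofSet (A j) (hA j)).toCurrent ψ) atTop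
      (𝓝 ((ofSet A' hA').toCurrent ψ)))
    {c : ℕ → V} {a : V} (ha : a ∈ (Ω : Set V)) (hc : Tendsto c atTop (𝓝 a)) {m : ℝ≥0∞}
    (hm : ∃ᶠ j in atTop, m ≤ lelongNumber (A j) (q + 1) (c j)) :
    m ≤ lelongNumber A' (q + 1) a :=
  (le_limsup_of_frequently_le hm).trans
    (limsup_lelongNumber_le_of_tendsto_ofSet_of_tendsto hA hA' hconv ha hc)

/-- **Limits of points of multiplicity `≥ 2` are singular points of the limit**: if `[A_j] → [A]`
in the sense of currents, `a_j → a` with `a ∈ A`, and `n(A_j, a_j) ≥ 2` for infinitely many `j`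
(e.g. `a_j ∈ sng A_j`), then `n(A, a) ≥ 2`, so `a ∈ sng A` (`n(A, ·) = 1` on `reg A`).
[cite: Chirka1989, §16.1 Prop. 1 (proof), p. 207; §11.1, p. 120] -/
theorem mem_singularLocus_of_tendsto_ofSet_of_frequently_two_le
    (hconv : ∀ ψ, Tendsto (fun j => (ofSet (A j) (hA j)).toCurrent ψ) atTop
      (𝓝 ((ofSet A' hA').toCurrent ψ)))
    {c : ℕ → V} {a : Ω} (haA : a ∈ A') (hc : Tendsto c atTop (𝓝 (a : V)))
    (h2 : ∃ᶠ j in atTop, 2 ≤ lelongNumber (A j) (q + 1) (c j)) :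
    a ∈ singularLocus 𝓘(ℂ, V) A' :=
  mem_singularLocus_of_two_le_lelongNumber hA' haA
    (le_lelongNumber_of_tendsto_ofSet_of_frequently_le hA hA' hconv a.2 hc h2)

/-- **`A_j → A` in the sense of §15.5** when `[A_j] → [A]` in the sense of currents: (i) the points
of `A` are exactly the points of `Ω` lying in every `cl(⋃_{j ≥ N} A_j)` — `A` is the limit set of
`{A_j}` in `Ω`; (ii) every compact `K ⊆ A` lies in the `ε`-neighbourhood of `A_j` for all large `j`.
[cite: Chirka1989, §16.1 Prop. 1 (last clause), p. 207; §15.5, pp. 203, 205] -/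
theorem tendsto_sets_of_tendsto_ofSet
    (hconv : ∀ ψ, Tendsto (fun j => (ofSet (A j) (hA j)).toCurrent ψ) atTop
      (𝓝 ((ofSet A' hA').toCurrent ψ))) :
    (∀ x ∈ (Ω : Set V), x ∈ ((↑) : Ω → V) '' A' ↔
      ∀ N : ℕ, x ∈ closure (⋃ j ≥ N, (((↑) : Ω → V) '' A j : Set V))) ∧
    (∀ K : Set V, IsCompact K → K ⊆ ((↑) : Ω → V) '' A' → ∀ ε : ℝ, 0 < ε →
      ∀ᶠ j in atTop, K ⊆ thickening ε (((↑) : Ω → V) '' A j)) := by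
  have h := tendsto_support_of_mult_nonneg (fun j => ofSet (A j) (hA j))
    (fun j Z => mult_ofSet_nonneg (hA j) Z) hconv
  simpa only [support_ofSet] using h

end Convergence

/-! ## §3. Compactness: analytic sets with locally uniformly bounded volumes -/

section Compactness

open HolomorphicChain

variable {A : ℕ → Set Ω} (hA : ∀ j, HasPureDim 𝓘(ℂ, V) (A j) (q + 1))

/-- **Compactness theorem for analytic sets as currents** [Chirka1989, §15.5 (p. 205) with §16.1
Prop. 1 (2)]: if the `A_j ⊆ Ω` are analytic of pure dimension `p = q + 1` with
`𝓗^{2p}(A_j ∩ K) ≤ M_K < ∞` for every compact `K ⊆ Ω`, then a subsequence of the currents `[A_j]`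
converges, in the sense of currents, to a POSITIVE holomorphic `p`-chain `T` (Chirka: "extract a
subsequence from `{μ_j = 𝓗_{2p}|_{A_j}}` weak-∗ converging to some measure `μ`"; here the limit is
identified as the holomorphic chain `T = Σ k_ν A_ν`, `‖T‖ = Σ k_ν 𝓗_{2p}|_{A_ν}`).
[cite: Chirka1989, §15.5, p. 205; §16.1 Prop. 1 (2), pp. 206–207] -/
theorem exists_subseq_tendsto_toCurrent_ofSet
    (hvol : ∀ K : Set V, IsCompact K → K ⊆ (Ω : Set V) → ∃ M : ℝ≥0∞, M < ⊤ ∧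
      ∀ j, (μHE[2 * (q + 1)] : Measure V) (((↑) : Ω → V) '' A j ∩ K) ≤ M) :
    ∃ (T : HolomorphicChain 𝓘(ℂ, V) Ω (q + 1)) (ι : ℕ → ℕ), StrictMono ι ∧
      (∀ ψ, Tendsto (fun j => (ofSet (A (ι j)) (hA (ι j))).toCurrent ψ) atTop
        (𝓝 (T.toCurrent ψ))) ∧
      ∀ Z, 0 ≤ T.mult Z := by
  refine exists_subseq_tendsto_toCurrent_of_mult_nonneg (fun j => ofSet (A j) (hA j))
    (fun j Z => mult_ofSet_nonneg (hA j) Z) fun K hK hKΩ => ?_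
  obtain ⟨M, hM, hle⟩ := hvol K hK hKΩ
  refine ⟨M, hM, fun j => ?_⟩
  rw [variation_toCurrent_ofSet_apply (hA j) hK.measurableSet]
  exact hle j

variable {T : HolomorphicChain 𝓘(ℂ, V) Ω (q + 1)}

/-- **The support of the limit chain is the limit set** [Chirka1989, §15.5, p. 205: "`A = supp μ ∩ Ω`
coincides with the limit set in `Ω` of the family `{A_j}`"]: if `[A_j] → [T]` in the sense of
currents with `T` positive, then a point of `Ω` lies on `|T|` iff it lies in every
`cl(⋃_{j ≥ N} A_j)`. [cite: Chirka1989, §15.5, p. 205; §16.1 Prop. 1, p. 207] -/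
theorem mem_image_support_iff_of_tendsto_ofSet
    (hconv : ∀ ψ, Tendsto (fun j => (ofSet (A j) (hA j)).toCurrent ψ) atTop (𝓝 (T.toCurrent ψ)))
    {x : V} (hx : x ∈ (Ω : Set V)) :
    x ∈ ((↑) : Ω → V) '' T.support ↔
      ∀ N : ℕ, x ∈ closure (⋃ j ≥ N, (((↑) : Ω → V) '' A j : Set V)) := by
  have h := (tendsto_support_of_mult_nonneg (fun j => ofSet (A j) (hA j))
    (fun j Z => mult_ofSet_nonneg (hA j) Z) hconv).1 x hx
  simpa only [support_ofSet] using h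

/-- **`A_j → |T|` in the sense of §15.5**: under the same hypotheses every compact `K ⊆ |T|` lies in
the `ε`-neighbourhood of `A_j` for all large `j`. [cite: Chirka1989, §15.5, p. 205; §16.1 Prop. 1, p. 207] -/
theorem eventually_subset_thickening_of_tendsto_ofSet
    (hconv : ∀ ψ, Tendsto (fun j => (ofSet (A j) (hA j)).toCurrent ψ) atTop (𝓝 (T.toCurrent ψ)))
    {K : Set V} (hK : IsCompact K) (hKT : K ⊆ ((↑) : Ω → V) '' T.support) {ε : ℝ} (hε : 0 < ε) :
    ∀ᶠ j in atTop, K ⊆ thickening ε (((↑) : Ω → V) '' A j) := by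
  have h := eventually_subset_thickening_of_tendsto (fun j => ofSet (A j) (hA j)) hconv hK hKT hε
  simpa only [support_ofSet] using h

/-- **Lower semicontinuity of the volume at the limit**: if `[A_j] → [T]` in the sense of currents
with `T` positive, then `𝓗^{2p}(|T| ∩ U) ≤ ‖T‖(U) ≤ liminf_j 𝓗^{2p}(A_j ∩ U)` for every open `U`
(every component of `T` carries an integer multiplicity `≥ 1`).
[cite: Chirka1989, §16.1 Prop. 1 (proof), p. 207; Federer1969, 4.1.5] -/
theorem measure_support_inter_le_liminf_of_tendsto_ofSet (hT : ∀ Z, 0 ≤ T.mult Z)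
    (hconv : ∀ ψ, Tendsto (fun j => (ofSet (A j) (hA j)).toCurrent ψ) atTop (𝓝 (T.toCurrent ψ)))
    {U : Set V} (hU : IsOpen U) :
    (μHE[2 * (q + 1)] : Measure V) (((↑) : Ω → V) '' T.support ∩ U) ≤
      liminf (fun j => (μHE[2 * (q + 1)] : Measure V) (((↑) : Ω → V) '' A j ∩ U)) atTop := by
  have h := variation_le_liminf_of_tendsto (fun j => ofSet (A j) (hA j)) hconv hU
  refine (T.measure_image_support_inter_le_variation hT hU.measurableSet).trans
    (h.trans_eq (liminf_congr (Eventually.of_forall fun j => ?_)))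
  exact variation_toCurrent_ofSet_apply (hA j) hU.measurableSet

/-- **The volumes `𝓗_{2p}|_{A_j}` converge weak-∗ to the mass measure `‖T‖ = Σ_ν k_ν 𝓗_{2p}|_{A_ν}`
of the limit chain**: `∫_{A_j} χ d𝓗^{2p} → ∫ χ d‖T‖` for every test function `χ` (Chirka's
`μ_j → μ`, with `μ` identified). [cite: Chirka1989, §15.5, p. 205; §16.1 Prop. 1, pp. 206–207] -/
theorem tendsto_setIntegral_variation_of_tendsto_ofSet (hT : ∀ Z, 0 ≤ T.mult Z)
    (hconv : ∀ ψ, Tendsto (fun j => (ofSet (A j) (hA j)).toCurrent ψ) atTop (𝓝 (T.toCurrent ψ)))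
    (χ : 𝓓(Ω, ℝ)) :
    Tendsto (fun j => ∫ x in ((↑) : Ω → V) '' A j, χ x ∂(μHE[2 * (q + 1)] : Measure V)) atTop
      (𝓝 (∫ x, χ x ∂T.toCurrent.variation)) := by
  have h := hconv (smulCovectorCLM (kaehlerPow (q + 1)) χ)
  rw [← T.integral_variation_toCurrent_eq hT χ] at h
  exact h.congr fun j => toCurrent_ofSet_smul_kaehlerPow_apply (hA j) χ

/-- **The volumes converge to the mass of the limit chain on continuity sets**: if `[A_j] → [T]`
with `T` positive and `S` has compact closure in `Ω` with `‖T‖(∂S) = 0`, then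
`𝓗^{2p}(A_j ∩ S) → ‖T‖(S) = Σ_ν k_ν 𝓗^{2p}(A_ν ∩ S)`. [cite: Chirka1989, §16.1 Prop. 1, p. 207] -/
theorem tendsto_measure_inter_variation_of_tendsto_ofSet
    (hconv : ∀ ψ, Tendsto (fun j => (ofSet (A j) (hA j)).toCurrent ψ) atTop (𝓝 (T.toCurrent ψ)))
    {S : Set V} (hS : MeasurableSet S) (hSc : IsCompact (closure S))
    (hSΩ : closure S ⊆ (Ω : Set V)) (hS0 : T.toCurrent.variation (frontier S) = 0) :
    Tendsto (fun j => (μHE[2 * (q + 1)] : Measure V) (((↑) : Ω → V) '' A j ∩ S)) atTop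
      (𝓝 (T.toCurrent.variation S)) := by
  have h := tendsto_variation_of_null_frontier (fun j => ofSet (A j) (hA j))
    (fun j Z => mult_ofSet_nonneg (hA j) Z) hconv hSc hSΩ hS0
  exact h.congr fun j => variation_toCurrent_ofSet_apply (hA j) hS

end Compactness

end Literature.Geometry.Kaehler

end
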